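import Literature.Analysis.ValidatedNumerics.FixedPointInterval
import HarnessLib

/-!
# Fluid computer blueprint — a kernel-evaluable DYADIC INTERVAL ARITHMETIC

HONEST FRAMING: low prior, high value-of-information experiment on Tao's machine paradigm; NOT a
claim that NS blows up. This file contains no dynamics at all: it is the arithmetic layer through
which the closed-form row conditions of the level-set transfer stage
(`ThresholdLevelStep.lean`, `ThresholdLevelExit.lean`: `LevelEntry.PassChain`,
`LevelTable.RowsValid`) are to be DECIDED by the kernel for an explicit dyadic table (bp3 gen 13).

## What this file is (bp3 gen 12, successor infrastructure)
A dyadic interval `I : DI` is a pair of integers `(lo, hi)`; at precision `P` it denotes the real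
interval `[lo / 2^P, hi / 2^P]`, membership being `DI.mem P I x : (lo : ℝ) ≤ x * 2^P ∧ x * 2^P ≤ hi`.
Every operation is INTEGER-ONLY (`+`, `*`, Euclidean `/` by positive divisors, comparisons,
structural recursion) so that `decide +kernel` evaluates it with the kernel's GMP arithmetic, and
every operation comes with a SOUNDNESS lemma `x ∈ I → y ∈ J → x ⋆ y ∈ I ⋆ J`:
`add`, `neg`, `sub`, `mul` (four products, floor/ceiling rescaling), `sq` (clipped at `0`),
`max`, `min`, `abs`, `inv`/`div` (positive divisor interval), `expNonpos` (for intervals of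
nonpositive reals: range reduction `x = 2^s u` with `|u| ≤ 1`, the Taylor bracket of
Mathlib's `Real.exp_bound`, then `s` certified squarings) and `sqrt` (integer square root found by
bitwise descent and CHECKED, not proved, at evaluation time — a failed check falls back to a
trivially sound bound). Design rule used throughout: whatever is cheaper to check at evaluation
time than to prove once (the integer square root, the range-reduction shift) is checked.
The floating-point / exact-rational twins of the level table (`bookkeep_v7.py`, `bookkeep_v8q.py` of
the pub-fluidc notes) are the specification this layer will evaluate.

## Relation to the tree's validated-numerics engines
`Literature/Analysis/ValidatedNumerics/FixedPointInterval.lean` (`Numerics.FI`, scale fixed at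
`2^48`) and `MultiPrecisionInterval.lean` (`NumericsMP.MI`, scale a parameter, `Option`-valued
division and `exp`) are the tree's engines; `DI.mem P I x` is `MI.mem (2^P) x I` up to argument
order.  This file REUSES their scale-free helpers (`Numerics.cdiv`, `fdiv_le_div`, `div_le_cdiv`,
`FI.mul_mem_corners`) and differs only in what the level-table checker needs: every operation is
TOTAL (side conditions are returned to the caller as Booleans — `posB`, `leB`, the `refineOK` of
`ThresholdLevelEnclose.lean` — instead of `Option`), `exp` is specialised to nonpositive arguments
with a trivially sound fallback, and `sqrt` is two-sided (checked integer square roots).  Refactor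
item for the librarian: `DI` could become a thin layer over `MI` once `MI` has `max`/`min`, a
two-sided `sqrt` and total variants of `divPos`/`exp`.
-/

open Set

namespace Literature.Analysis.FluidPDE.FluidComputer

/-- **A dyadic interval**: integers `lo, hi` denoting `[lo / 2^P, hi / 2^P]` at precision `P`.
[folklore] -/
structure DI where
  /-- scaled lower end -/
  lo : ℤ
  /-- scaled upper end -/
  hi : ℤ
  deriving DecidableEq, Repr

namespace DI

open Literature.Analysis.ValidatedNumerics.Numerics (cdiv fdiv_le_div div_le_cdiv)

/-- Membership of a real number in a dyadic interval at precision `P`. [folklore] -/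
def mem (P : ℕ) (I : DI) (x : ℝ) : Prop := (I.lo : ℝ) ≤ x * 2 ^ P ∧ x * 2 ^ P ≤ (I.hi : ℝ)

/-- The point interval of the dyadic `m / 2^P`. [folklore] -/
def pt (m : ℤ) : DI := ⟨m, m⟩

/-- [folklore] -/
theorem mem_pt (P : ℕ) (m : ℤ) : (pt m).mem P ((m : ℝ) / 2 ^ P) := by
  simp only [mem, div_mul_cancel₀ _ (pow_ne_zero P (two_ne_zero (α := ℝ)))]
  exact ⟨le_rfl, le_rfl⟩

/-- [folklore] -/
theorem mem_pt_iff (P : ℕ) (m : ℤ) (x : ℝ) : (pt m).mem P x ↔ x = (m : ℝ) / 2 ^ P := by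
  have h2 : (0 : ℝ) < 2 ^ P := pow_pos two_pos P
  simp only [mem]
  constructor
  · rintro ⟨h1, h2'⟩
    have : x * 2 ^ P = m := le_antisymm h2' h1
    rw [← this, mul_div_cancel_right₀ _ h2.ne']
  · rintro rfl
    rw [div_mul_cancel₀ _ h2.ne']
    exact ⟨le_rfl, le_rfl⟩

/-- Sum. [folklore] -/
def add (I J : DI) : DI := ⟨I.lo + J.lo, I.hi + J.hi⟩

/-- [folklore] -/
theorem mem_add {P : ℕ} {I J : DI} {x y : ℝ} (hx : I.mem P x) (hy : J.mem P y) :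
    (I.add J).mem P (x + y) := by
  obtain ⟨h1, h2⟩ := hx; obtain ⟨h3, h4⟩ := hy
  simp only [mem, add, Int.cast_add]
  constructor <;> nlinarith

/-- Negation. [folklore] -/
def neg (I : DI) : DI := ⟨-I.hi, -I.lo⟩

/-- [folklore] -/
theorem mem_neg {P : ℕ} {I : DI} {x : ℝ} (hx : I.mem P x) : I.neg.mem P (-x) := by
  obtain ⟨h1, h2⟩ := hx
  simp only [mem, neg, Int.cast_neg]
  constructor <;> linarith

/-- Difference. [folklore] -/
def sub (I J : DI) : DI := I.add J.neg

/-- [folklore] -/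
theorem mem_sub {P : ℕ} {I J : DI} {x y : ℝ} (hx : I.mem P x) (hy : J.mem P y) :
    (I.sub J).mem P (x - y) := by
  rw [sub_eq_add_neg]; exact mem_add hx (mem_neg hy)

/-- Minimum / maximum of four. [folklore] -/
def min4 (p q r s : ℤ) : ℤ := min (min p q) (min r s)

/-- [folklore] -/
def max4 (p q r s : ℤ) : ℤ := max (max p q) (max r s)

/-- Product at precision `P`: the four endpoint products, rescaled by floor / ceiling division by
`2^P`. [folklore] -/
def mul (P : ℕ) (I J : DI) : DI :=
  ⟨min4 (I.lo * J.lo) (I.lo * J.hi) (I.hi * J.lo) (I.hi * J.hi) / 2 ^ P,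
    cdiv (max4 (I.lo * J.lo) (I.lo * J.hi) (I.hi * J.lo) (I.hi * J.hi)) (2 ^ P)⟩

/-- [folklore] -/
theorem mem_mul {P : ℕ} {I J : DI} {x y : ℝ} (hx : I.mem P x) (hy : J.mem P y) :
    (I.mul P J).mem P (x * y) := by
  have h2 : (0 : ℝ) < 2 ^ P := pow_pos two_pos P
  have h2z : (0 : ℤ) < 2 ^ P := pow_pos two_pos P
  have key := Literature.Analysis.ValidatedNumerics.Numerics.FI.mul_mem_corners hx hy
  have hprod : x * 2 ^ P * (y * 2 ^ P) = x * y * 2 ^ P * 2 ^ P := by ring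
  rw [hprod] at key
  obtain ⟨k1, k2⟩ := key
  simp only [mem, mul]
  constructor
  · have hf := fdiv_le_div (a := min4 (I.lo * J.lo) (I.lo * J.hi) (I.hi * J.lo) (I.hi * J.hi)) h2z
    have hmin : ((min4 (I.lo * J.lo) (I.lo * J.hi) (I.hi * J.lo) (I.hi * J.hi) : ℤ) : ℝ) ≤
        x * y * 2 ^ P * 2 ^ P := by
      simp only [min4, Int.cast_min, Int.cast_mul]; exact k1
    have : ((min4 (I.lo * J.lo) (I.lo * J.hi) (I.hi * J.lo) (I.hi * J.hi) : ℤ) : ℝ) / (2 ^ P : ℤ) ≤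
        x * y * 2 ^ P := by
      push_cast
      rw [div_le_iff₀ h2]; exact hmin
    exact hf.trans this
  · have hc := div_le_cdiv (a := max4 (I.lo * J.lo) (I.lo * J.hi) (I.hi * J.lo) (I.hi * J.hi)) h2z
    have hmax : x * y * 2 ^ P * 2 ^ P ≤
        ((max4 (I.lo * J.lo) (I.lo * J.hi) (I.hi * J.lo) (I.hi * J.hi) : ℤ) : ℝ) := by
      simp only [max4, Int.cast_max, Int.cast_mul]; exact k2
    have : x * y * 2 ^ P ≤
        ((max4 (I.lo * J.lo) (I.lo * J.hi) (I.hi * J.lo) (I.hi * J.hi) : ℤ) : ℝ) / (2 ^ P : ℤ) := by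
      push_cast
      rw [le_div_iff₀ h2]; exact hmax
    exact this.trans hc

/-- Square at precision `P` (the product with itself, lower end clipped at `0`). [folklore] -/
def sq (P : ℕ) (I : DI) : DI := let M := I.mul P I; ⟨max M.lo 0, M.hi⟩

/-- [folklore] -/
theorem mem_sq {P : ℕ} {I : DI} {x : ℝ} (hx : I.mem P x) : (I.sq P).mem P (x ^ 2) := by
  have h := mem_mul hx hx
  rw [← pow_two] at h
  obtain ⟨h1, h2⟩ := h
  simp only [mem, sq, Int.cast_max, Int.cast_zero, max_le_iff]
  exact ⟨⟨h1, by positivity⟩, h2⟩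

/-- Maximum. [folklore] -/
def max (I J : DI) : DI := ⟨Max.max I.lo J.lo, Max.max I.hi J.hi⟩

/-- [folklore] -/
theorem mem_max {P : ℕ} {I J : DI} {x y : ℝ} (hx : I.mem P x) (hy : J.mem P y) :
    (I.max J).mem P (Max.max x y) := by
  obtain ⟨h1, h2⟩ := hx; obtain ⟨h3, h4⟩ := hy
  have h2P : (0 : ℝ) ≤ 2 ^ P := pow_nonneg zero_le_two P
  simp only [mem, max, Int.cast_max, max_mul_of_nonneg x y h2P]
  exact ⟨max_le_max h1 h3, max_le_max h2 h4⟩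

/-- Minimum. [folklore] -/
def min (I J : DI) : DI := ⟨Min.min I.lo J.lo, Min.min I.hi J.hi⟩

/-- [folklore] -/
theorem mem_min {P : ℕ} {I J : DI} {x y : ℝ} (hx : I.mem P x) (hy : J.mem P y) :
    (I.min J).mem P (Min.min x y) := by
  obtain ⟨h1, h2⟩ := hx; obtain ⟨h3, h4⟩ := hy
  have h2P : (0 : ℝ) ≤ 2 ^ P := pow_nonneg zero_le_two P
  simp only [mem, min, Int.cast_min, min_mul_of_nonneg x y h2P]
  exact ⟨min_le_min h1 h3, min_le_min h2 h4⟩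

/-- Absolute value (as `max x (-x)`, lower end clipped at `0`). [folklore] -/
def abs (I : DI) : DI := let M := I.max I.neg; ⟨Max.max M.lo 0, M.hi⟩

/-- [folklore] -/
theorem mem_abs {P : ℕ} {I : DI} {x : ℝ} (hx : I.mem P x) : I.abs.mem P |x| := by
  have h := mem_max hx (mem_neg hx)
  rw [← abs_eq_max_neg] at h
  obtain ⟨h1, h2⟩ := h
  simp only [mem, abs, Int.cast_max, Int.cast_zero, max_le_iff]
  exact ⟨⟨h1, by positivity⟩, h2⟩

/-! ### Reciprocal and quotient (positive divisor interval) -/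

/-- Reciprocal of a positive interval at precision `P`: `(1/y)·2^P = (2^P·2^P)/(y·2^P)`.
[folklore] -/
def inv (P : ℕ) (J : DI) : DI := ⟨2 ^ P * 2 ^ P / J.hi, cdiv (2 ^ P * 2 ^ P) J.lo⟩

/-- [folklore] -/
theorem mem_inv {P : ℕ} {J : DI} {y : ℝ} (hJ : 0 < J.lo) (hy : J.mem P y) :
    (J.inv P).mem P (1 / y) := by
  obtain ⟨h1, h2⟩ := hy
  have h2P : (0 : ℝ) < 2 ^ P := pow_pos two_pos P
  have hlo : (0 : ℝ) < J.lo := by exact_mod_cast hJ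
  have hY : 0 < y * 2 ^ P := hlo.trans_le h1
  have hy0 : 0 < y := by
    by_contra h
    push Not at h
    have : y * 2 ^ P ≤ 0 := mul_nonpos_of_nonpos_of_nonneg h h2P.le
    linarith
  have hhi : (0 : ℝ) < J.hi := hY.trans_le h2
  have hhiZ : 0 < J.hi := by exact_mod_cast hhi
  have hval : 1 / y * 2 ^ P = (2 ^ P * 2 ^ P) / (y * 2 ^ P) := by
    field_simp
  simp only [mem, inv, hval]
  constructor
  · have hf := fdiv_le_div (a := 2 ^ P * 2 ^ P) hhiZ
    push_cast at hf
    exact hf.trans (div_le_div_of_nonneg_left (by positivity) hY h2)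
  · have hc := div_le_cdiv (a := 2 ^ P * 2 ^ P) hJ
    push_cast at hc
    exact (div_le_div_of_nonneg_left (by positivity) hlo h1).trans hc

/-- Quotient at precision `P` (divisor interval positive). [folklore] -/
def div (P : ℕ) (I J : DI) : DI := I.mul P (J.inv P)

/-- [folklore] -/
theorem mem_div {P : ℕ} {I J : DI} {x y : ℝ} (hJ : 0 < J.lo) (hx : I.mem P x) (hy : J.mem P y) :
    (I.div P J).mem P (x / y) := by
  rw [div_eq_mul_one_div]
  exact mem_mul hx (mem_inv hJ hy)

/-- Scaling by a natural number literal `c` (exact). [folklore] -/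
def smul (c : ℕ) (I : DI) : DI := ⟨(c : ℤ) * I.lo, (c : ℤ) * I.hi⟩

/-- [folklore] -/
theorem mem_smul {P : ℕ} (c : ℕ) {I : DI} {x : ℝ} (hx : I.mem P x) :
    (I.smul c).mem P ((c : ℝ) * x) := by
  obtain ⟨h1, h2⟩ := hx
  have hc : (0 : ℝ) ≤ c := Nat.cast_nonneg c
  simp only [mem, smul, Int.cast_mul, Int.cast_natCast, mul_assoc]
  exact ⟨mul_le_mul_of_nonneg_left h1 hc, mul_le_mul_of_nonneg_left h2 hc⟩

/-- Sign tests used by the row checker: `I ≤ J` pointwise-certainly, positivity, etc.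
[folklore] -/
def leB (I J : DI) : Bool := decide (I.hi ≤ J.lo)

/-- [folklore] -/
theorem le_of_leB {P : ℕ} {I J : DI} {x y : ℝ} (h : leB I J = true) (hx : I.mem P x)
    (hy : J.mem P y) : x ≤ y := by
  have h2P : (0 : ℝ) < 2 ^ P := pow_pos two_pos P
  have hIJ : I.hi ≤ J.lo := of_decide_eq_true h
  have hIJ' : (I.hi : ℝ) ≤ J.lo := by exact_mod_cast hIJ
  nlinarith [hx.2, hy.1]

/-- [folklore] -/
def posB (I : DI) : Bool := decide (0 < I.lo)

/-- [folklore] -/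
theorem pos_of_posB {P : ℕ} {I : DI} {x : ℝ} (h : posB I = true) (hx : I.mem P x) : 0 < x := by
  have h2P : (0 : ℝ) < 2 ^ P := pow_pos two_pos P
  have h0 : 0 < I.lo := of_decide_eq_true h
  have h0' : (0 : ℝ) < I.lo := by exact_mod_cast h0
  nlinarith [hx.1]

/-- [folklore] -/
def nonnegB (I : DI) : Bool := decide (0 ≤ I.lo)

/-- [folklore] -/
theorem nonneg_of_nonnegB {P : ℕ} {I : DI} {x : ℝ} (h : nonnegB I = true) (hx : I.mem P x) :
    0 ≤ x := by
  have h2P : (0 : ℝ) < 2 ^ P := pow_pos two_pos P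
  have h0 : 0 ≤ I.lo := of_decide_eq_true h
  have h0' : (0 : ℝ) ≤ I.lo := by exact_mod_cast h0
  nlinarith [hx.1]

/-- Membership is monotone under containment of the integer ends. [folklore] -/
theorem mem_of_mem_of_le {P : ℕ} {I J : DI} {x : ℝ} (hx : I.mem P x) (h1 : J.lo ≤ I.lo)
    (h2 : I.hi ≤ J.hi) : J.mem P x := by
  have h1' : (J.lo : ℝ) ≤ I.lo := by exact_mod_cast h1
  have h2' : (I.hi : ℝ) ≤ J.hi := by exact_mod_cast h2
  exact ⟨h1'.trans hx.1, hx.2.trans h2'⟩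

/-- The hull of two intervals. [folklore] -/
def hull (I J : DI) : DI := ⟨Min.min I.lo J.lo, Max.max I.hi J.hi⟩

/-- [folklore] -/
theorem mem_hull_left {P : ℕ} {I J : DI} {x : ℝ} (hx : I.mem P x) : (I.hull J).mem P x :=
  mem_of_mem_of_le hx (min_le_left _ _) (le_max_left _ _)

/-- [folklore] -/
theorem mem_hull_right {P : ℕ} {I J : DI} {x : ℝ} (hx : J.mem P x) : (I.hull J).mem P x :=
  mem_of_mem_of_le hx (min_le_right _ _) (le_max_right _ _)

/-- A real number between two members of intervals lies in their hull. [folklore] -/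
theorem mem_hull_of_between {P : ℕ} {I J : DI} {x y z : ℝ} (hx : I.mem P x) (hz : J.mem P z)
    (h1 : x ≤ y) (h2 : y ≤ z) : (I.hull J).mem P y := by
  have h2P : (0 : ℝ) < 2 ^ P := pow_pos two_pos P
  refine ⟨?_, ?_⟩
  · have : (Min.min I.lo J.lo : ℤ) ≤ (I.lo : ℝ) := by exact_mod_cast min_le_left _ _
    simp only [hull, Int.cast_min] at *
    nlinarith [hx.1, min_le_left (I.lo : ℝ) J.lo]
  · simp only [hull, Int.cast_max]
    nlinarith [hz.2, le_max_right (I.hi : ℝ) J.hi]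

/-! ### The exponential on nonpositive arguments

`e^x` for `x ≤ 0` only (all the level-table rates are decaying exponentials): range reduction
`x = 2^s · u` with `-1 ≤ u ≤ 0`, the Taylor bracket `|e^u - Σ_{i<n} u^i/i!| ≤ |u|^n (n+1)/(n!·n)`
of `Real.exp_bound`, then `s` squarings. -/

/-- `taylorNum m P k = Σ_{i ≤ k} m^i · 2^{P(k-i)} · k!/i!`, by structural recursion (so that the
kernel evaluates it): the scaled Taylor polynomial of `exp` at `u = m / 2^P`. [folklore] -/
def taylorNum (m : ℤ) (P : ℕ) : ℕ → ℤ
  | 0 => 1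
  | k + 1 => taylorNum m P k * ((k + 1 : ℕ) : ℤ) * 2 ^ P + m ^ (k + 1)

/-- [folklore] -/
theorem taylorNum_eq (m : ℤ) (P k : ℕ) :
    (taylorNum m P k : ℝ) =
      (2 : ℝ) ^ (P * k) * k.factorial * ∑ i ∈ Finset.range (k + 1), ((m : ℝ) / 2 ^ P) ^ i / i.factorial := by
  induction k with
  | zero => simp [taylorNum]
  | succ k ih =>
    have h2P : (2 : ℝ) ^ P ≠ 0 := pow_ne_zero P two_ne_zero
    have hk : ((k + 1).factorial : ℝ) ≠ 0 := by exact_mod_cast (Nat.factorial_pos _).ne'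
    rw [Finset.sum_range_succ, mul_add]
    simp only [taylorNum, Int.cast_add, Int.cast_mul, Int.cast_pow, Int.cast_natCast, ih,
      Nat.factorial_succ, Nat.cast_mul, Nat.cast_add, Nat.cast_one, pow_succ, mul_add_one (α := ℕ),
      pow_add]
    have e2 : ((m : ℝ) / 2 ^ P) ^ k * ((m : ℝ) / 2 ^ P) = (m : ℝ) ^ (k + 1) / (2 ^ (P * k) * 2 ^ P) := by
      rw [← pow_succ, div_pow, pow_mul]; ring
    rw [e2]
    field_simp
    ring

/-- The Taylor bracket of `e^{m/2^P} · 2^P` with `n` terms (intended for `-2^P ≤ m ≤ 0`, `0 < n`),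
clipped to `[0, 2^P]`. [folklore] -/
def expPt (P n : ℕ) (m : ℤ) : DI :=
  let num : ℤ := taylorNum m P (n - 1) * 2 ^ P
  let den : ℤ := 2 ^ (P * (n - 1)) * ((n - 1).factorial : ℕ)
  let enum : ℤ := (-m) ^ n * ((n + 1 : ℕ) : ℤ) * 2 ^ P
  let eden : ℤ := 2 ^ (P * n) * ((n.factorial * n : ℕ) : ℤ)
  ⟨Max.max ((num * eden - enum * den) / (den * eden)) 0,
    Min.min (cdiv (num * eden + enum * den) (den * eden)) (2 ^ P)⟩

/-- [folklore] -/
theorem mem_expPt {P n : ℕ} (hn : 0 < n) {m : ℤ} (hm0 : m ≤ 0) (hm1 : -(2 : ℤ) ^ P ≤ m) :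
    (expPt P n m).mem P (Real.exp ((m : ℝ) / 2 ^ P)) := by
  have h2P : (0 : ℝ) < 2 ^ P := pow_pos two_pos P
  set u : ℝ := (m : ℝ) / 2 ^ P with hu
  have hu0 : u ≤ 0 := div_nonpos_of_nonpos_of_nonneg (by exact_mod_cast hm0) h2P.le
  have hu1 : |u| ≤ 1 := by
    rw [abs_of_nonpos hu0, hu, neg_le, le_div_iff₀ h2P]
    have : ((-(2 : ℤ) ^ P : ℤ) : ℝ) ≤ m := by exact_mod_cast hm1
    push_cast at this
    linarith
  have habs : |u| = ((-m : ℤ) : ℝ) / 2 ^ P := by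
    rw [abs_of_nonpos hu0, hu]; push_cast; ring
  -- the Taylor bracket
  have hb := Real.exp_bound hu1 hn
  set S : ℝ := ∑ i ∈ Finset.range n, u ^ i / i.factorial with hS
  set R : ℝ := |u| ^ n * ((n.succ : ℝ) / (n.factorial * n)) with hR
  have hlow : S - R ≤ Real.exp u := by have := (abs_sub_le_iff.1 hb).2; linarith
  have hupp : Real.exp u ≤ S + R := by have := (abs_sub_le_iff.1 hb).1; linarith
  -- the integers
  obtain ⟨k, rfl⟩ : ∃ k, n = k + 1 := ⟨n - 1, (Nat.succ_pred_eq_of_pos hn).symm⟩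
  simp only [expPt, Nat.add_sub_cancel, mem, Int.cast_max, Int.cast_min, Int.cast_zero,
    Int.cast_pow, Int.cast_ofNat, max_le_iff, le_min_iff]
  set den : ℤ := 2 ^ (P * k) * (k.factorial : ℕ) with hden
  set eden : ℤ := 2 ^ (P * (k + 1)) * (((k + 1).factorial * (k + 1) : ℕ) : ℤ) with heden
  set num : ℤ := taylorNum m P k * 2 ^ P with hnum
  set enum : ℤ := (-m) ^ (k + 1) * ((k + 1 + 1 : ℕ) : ℤ) * 2 ^ P with henum
  have hden0 : (0 : ℝ) < den := by
    rw [hden]; push_cast; exact mul_pos (by positivity) (by exact_mod_cast Nat.factorial_pos k)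
  have heden0 : (0 : ℝ) < eden := by
    rw [heden]; push_cast
    exact mul_pos (by positivity) (mul_pos (by exact_mod_cast Nat.factorial_pos _) (by positivity))
  have hdenZ : (0 : ℤ) < den * eden := by
    have : (0 : ℝ) < (den : ℝ) * eden := mul_pos hden0 heden0
    exact_mod_cast this
  -- num / den = S · 2^P
  have hS' : (num : ℝ) / den = S * 2 ^ P := by
    rw [hnum, hden, hS]; push_cast
    rw [taylorNum_eq]
    field_simp
    simp only [hu]
  -- enum / eden = R · 2^P
  have hR' : (enum : ℝ) / eden = R * 2 ^ P := by
    rw [henum, heden, hR, habs]; push_cast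
    rw [div_pow, ← pow_mul]
    field_simp
  have hfrac1 : ((num * eden - enum * den : ℤ) : ℝ) / ((den * eden : ℤ) : ℝ) = (S - R) * 2 ^ P := by
    push_cast
    rw [sub_mul, ← hS', ← hR']
    field_simp
  have hfrac2 : ((num * eden + enum * den : ℤ) : ℝ) / ((den * eden : ℤ) : ℝ) = (S + R) * 2 ^ P := by
    push_cast
    rw [add_mul, ← hS', ← hR']
    field_simp
  refine ⟨⟨?_, by positivity⟩, ?_, ?_⟩
  · have hf := fdiv_le_div (a := num * eden - enum * den) hdenZ
    rw [hfrac1] at hf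
    exact hf.trans (mul_le_mul_of_nonneg_right hlow h2P.le)
  · have hc := div_le_cdiv (a := num * eden + enum * den) hdenZ
    rw [hfrac2] at hc
    exact (mul_le_mul_of_nonneg_right hupp h2P.le).trans hc
  · have : Real.exp u ≤ 1 := Real.exp_le_one_iff.2 hu0
    nlinarith

/-- One certified squaring step at precision `P` for a nonnegative value. [folklore] -/
def sqStep (P : ℕ) (I : DI) : DI :=
  ⟨Max.max I.lo 0 * Max.max I.lo 0 / 2 ^ P, cdiv (I.hi * I.hi) (2 ^ P)⟩

/-- [folklore] -/
theorem mem_sqStep {P : ℕ} {I : DI} {z : ℝ} (hz : 0 ≤ z) (hI : I.mem P z) :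
    (sqStep P I).mem P (z ^ 2) := by
  obtain ⟨h1, h2⟩ := hI
  have h2P : (0 : ℝ) < 2 ^ P := pow_pos two_pos P
  have h2Z : (0 : ℤ) < 2 ^ P := pow_pos two_pos P
  have hZ : 0 ≤ z * 2 ^ P := mul_nonneg hz h2P.le
  have hval : z ^ 2 * 2 ^ P = (z * 2 ^ P) * (z * 2 ^ P) / 2 ^ P := by
    field_simp
  simp only [mem, sqStep, hval]
  constructor
  · have hf := fdiv_le_div (a := Max.max I.lo 0 * Max.max I.lo 0) h2Z
    push_cast at hf
    refine hf.trans (div_le_div_of_nonneg_right ?_ h2P.le)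
    have hl : Max.max (I.lo : ℝ) 0 ≤ z * 2 ^ P := max_le h1 hZ
    have hl0 : 0 ≤ Max.max (I.lo : ℝ) 0 := le_max_right _ _
    exact mul_le_mul hl hl hl0 hZ
  · have hc := div_le_cdiv (a := I.hi * I.hi) h2Z
    push_cast at hc
    refine (div_le_div_of_nonneg_right ?_ h2P.le).trans hc
    exact mul_le_mul h2 h2 hZ (hZ.trans h2)

/-- `s` certified squarings: `z ↦ z^(2^s)`. [folklore] -/
def sqIter (P : ℕ) : ℕ → DI → DI
  | 0, I => I
  | s + 1, I => sqIter P s (sqStep P I)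

/-- [folklore] -/
theorem mem_sqIter {P : ℕ} (s : ℕ) : ∀ {I : DI} {z : ℝ}, 0 ≤ z → I.mem P z →
    (sqIter P s I).mem P (z ^ (2 ^ s)) := by
  induction s with
  | zero => intro I z _ hI; simpa [sqIter] using hI
  | succ s ih =>
    intro I z hz hI
    have h := ih (pow_nonneg hz 2) (mem_sqStep hz hI)
    rw [← pow_mul, ← pow_succ'] at h
    simpa [sqIter] using h

/-- A range-reduction shift: roughly the least `s ≤ fuel` with `a / 2^s ≤ bound` (only its value
is used; soundness of `expNonpos` does not depend on it). [folklore] -/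
def shiftFor (bound : ℤ) : ℤ → ℕ → ℕ
  | _, 0 => 0
  | a, fuel + 1 => if a ≤ bound then 0 else shiftFor bound (cdiv a 2) fuel + 1

/-- `e^x · 2^P` for an interval of NONPOSITIVE reals: range reduction by `2^s`, point brackets at the
two ends (monotonicity of `exp`), `s` squarings; falls back to the trivially sound `[0, 2^P]` if the
range reduction check fails. [folklore] -/
def expNonpos (P n : ℕ) (I : DI) : DI :=
  let s := shiftFor (2 ^ (P - 1)) (-I.lo) 64
  let mlo := I.lo / 2 ^ s
  let mhi := Min.min (cdiv I.hi (2 ^ s)) 0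
  if -(2 : ℤ) ^ P ≤ mlo ∧ mlo ≤ mhi ∧ I.hi ≤ 0 then
    sqIter P s ⟨(expPt P n mlo).lo, (expPt P n mhi).hi⟩
  else ⟨0, 2 ^ P⟩

/-- [folklore] -/
theorem mem_expNonpos {P n : ℕ} (hn : 0 < n) {I : DI} {x : ℝ} (hI : I.hi ≤ 0) (hx : I.mem P x) :
    (expNonpos P n I).mem P (Real.exp x) := by
  have h2P : (0 : ℝ) < 2 ^ P := pow_pos two_pos P
  obtain ⟨h1, h2⟩ := hx
  have hx0 : x ≤ 0 := by
    have : (I.hi : ℝ) ≤ 0 := by exact_mod_cast hI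
    nlinarith
  simp only [expNonpos]
  set s := shiftFor (2 ^ (P - 1)) (-I.lo) 64 with hs
  split_ifs with hcond
  · obtain ⟨hm1, hmm, -⟩ := hcond
    have h2s : (0 : ℝ) < 2 ^ s := pow_pos two_pos s
    have h2sZ : (0 : ℤ) < 2 ^ s := pow_pos two_pos s
    set u : ℝ := x / 2 ^ s with hu
    have hxu : x = (2 ^ s : ℕ) * u := by rw [hu]; push_cast; field_simp
    have hexp : Real.exp x = Real.exp u ^ (2 ^ s) := by rw [hxu, Real.exp_nat_mul]
    rw [hexp]
    have hu0 : 0 ≤ Real.exp u := (Real.exp_pos u).le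
    apply mem_sqIter s hu0
    -- the two point brackets
    have hmlo0 : I.lo / 2 ^ s ≤ Min.min (cdiv I.hi (2 ^ s)) 0 := hmm
    have hmhi0 : Min.min (cdiv I.hi (2 ^ s)) 0 ≤ 0 := min_le_right _ _
    have hlo_le : ((I.lo / 2 ^ s : ℤ) : ℝ) / 2 ^ P ≤ u := by
      have hf := fdiv_le_div (a := I.lo) h2sZ
      push_cast at hf
      rw [div_le_iff₀ h2P, hu]
      refine hf.trans ?_
      have : x / 2 ^ s * 2 ^ P = (x * 2 ^ P) / 2 ^ s := by ring
      rw [this]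
      exact div_le_div_of_nonneg_right h1 h2s.le
    have hhi_ge : u ≤ ((Min.min (cdiv I.hi (2 ^ s)) 0 : ℤ) : ℝ) / 2 ^ P := by
      rw [le_div_iff₀ h2P, hu, Int.cast_min, Int.cast_zero, le_min_iff]
      constructor
      · have hc := div_le_cdiv (a := I.hi) h2sZ
        push_cast at hc
        refine le_trans ?_ hc
        have : x / 2 ^ s * 2 ^ P = (x * 2 ^ P) / 2 ^ s := by ring
        rw [this]
        exact div_le_div_of_nonneg_right h2 h2s.le
      · have : x / 2 ^ s * 2 ^ P = x * 2 ^ P / 2 ^ s := by ring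
        rw [this]
        exact div_nonpos_of_nonpos_of_nonneg (by nlinarith) h2s.le
    have hA := mem_expPt (P := P) hn (hmlo0.trans hmhi0) hm1
    have hB := mem_expPt (P := P) hn hmhi0 (hm1.trans hmlo0)
    refine ⟨hA.1.trans ?_, le_trans ?_ hB.2⟩
    · exact mul_le_mul_of_nonneg_right (Real.exp_le_exp.2 hlo_le) h2P.le
    · exact mul_le_mul_of_nonneg_right (Real.exp_le_exp.2 hhi_ge) h2P.le
  · simp only [mem, Int.cast_zero, Int.cast_pow, Int.cast_ofNat]
    refine ⟨by positivity, ?_⟩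
    have : Real.exp x ≤ 1 := Real.exp_le_one_iff.2 hx0
    nlinarith

/-- Cube at precision `P`. [folklore] -/
def cube (P : ℕ) (I : DI) : DI := (I.sq P).mul P I

/-- [folklore] -/
theorem mem_cube {P : ℕ} {I : DI} {x : ℝ} (hx : I.mem P x) : (I.cube P).mem P (x ^ 3) := by
  have h := mem_mul (mem_sq hx) hx
  rw [← pow_succ] at h
  exact h

/-! ### Square root (checked integer square root) -/

/-- Bitwise-descent integer square root, inner loop (structural in the bit counter). [folklore] -/
def isqrtAux (n : ℕ) : ℕ → ℕ → ℕ
  | 0, r => r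
  | k + 1, r => if (r + 2 ^ k) * (r + 2 ^ k) ≤ n then isqrtAux n k (r + 2 ^ k) else isqrtAux n k r

/-- Integer square root candidate (its correctness is CHECKED where used, not proved). [folklore] -/
def isqrt (n : ℕ) : ℕ := isqrtAux n (Nat.log2 n / 2 + 1) 0

/-- A checked lower integer square root: `r` with `r * r ≤ N`. [folklore] -/
def sqrtLoNat (N : ℕ) : ℕ := if isqrt N * isqrt N ≤ N then isqrt N else 0

/-- A checked strict upper integer square root: `R` with `N < R * R`. [folklore] -/
def sqrtHiNat (N : ℕ) : ℕ := if N < (isqrt N + 1) * (isqrt N + 1) then isqrt N + 1 else N + 1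

/-- [folklore] -/
theorem sqrtLoNat_mul_self_le (N : ℕ) : sqrtLoNat N * sqrtLoNat N ≤ N := by
  unfold sqrtLoNat; split_ifs with h
  · exact h
  · simp

/-- [folklore] -/
theorem lt_sqrtHiNat_mul_self (N : ℕ) : N < sqrtHiNat N * sqrtHiNat N := by
  unfold sqrtHiNat; split_ifs with h
  · exact h
  · nlinarith

/-- Square root at precision `P`: `√x · 2^P = √((x·2^P)·2^P)`, bracketed by checked integer square
roots of `lo·2^P` and `hi·2^P` (negative ends clipped to `0`; `√x = 0` for `x ≤ 0` as in Mathlib).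
[folklore] -/
def sqrt (P : ℕ) (I : DI) : DI :=
  ⟨(sqrtLoNat (I.lo.toNat * 2 ^ P) : ℤ), (sqrtHiNat (I.hi.toNat * 2 ^ P) : ℤ)⟩

/-- [folklore] -/
theorem mem_sqrt {P : ℕ} {I : DI} {x : ℝ} (hx : I.mem P x) : (I.sqrt P).mem P (Real.sqrt x) := by
  obtain ⟨h1, h2⟩ := hx
  have h2P : (0 : ℝ) < 2 ^ P := pow_pos two_pos P
  have hval : Real.sqrt x * 2 ^ P = Real.sqrt (x * 2 ^ P * 2 ^ P) := by
    rw [mul_assoc, ← pow_two, Real.sqrt_mul' x (by positivity), Real.sqrt_sq h2P.le]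
  simp only [mem, sqrt, Int.cast_natCast, hval]
  have hX2 : x * 2 ^ P * 2 ^ P ≤ (I.hi.toNat : ℕ) * 2 ^ P := by
    have hhi : (I.hi : ℝ) ≤ ((I.hi.toNat : ℕ) : ℝ) := by exact_mod_cast Int.self_le_toNat I.hi
    nlinarith
  constructor
  · -- lower end
    set N := I.lo.toNat * 2 ^ P with hN
    have hr := sqrtLoNat_mul_self_le N
    rcases le_or_gt I.lo 0 with hlo | hlo
    · have hN0 : N = 0 := by rw [hN, Int.toNat_of_nonpos hlo, zero_mul]
      rw [hN0] at hr
      have h0 : sqrtLoNat 0 = 0 := by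
        rcases Nat.eq_zero_or_pos (sqrtLoNat 0) with h | h
        · exact h
        · nlinarith
      rw [hN0, h0, Nat.cast_zero]
      exact Real.sqrt_nonneg _
    · have hloN : ((I.lo.toNat : ℕ) : ℝ) = (I.lo : ℝ) := by
        have : (I.lo.toNat : ℤ) = I.lo := Int.toNat_of_nonneg hlo.le
        exact_mod_cast this
      apply Real.le_sqrt_of_sq_le
      have hr' : ((sqrtLoNat N : ℕ) : ℝ) ^ 2 ≤ (N : ℝ) := by rw [pow_two]; exact_mod_cast hr
      refine hr'.trans ?_
      rw [hN]; push_cast; rw [hloN]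
      nlinarith
  · -- upper end
    set N := I.hi.toNat * 2 ^ P with hN
    have hR := lt_sqrtHiNat_mul_self N
    have hR1 : 0 < sqrtHiNat N := by
      rcases Nat.eq_zero_or_pos (sqrtHiNat N) with h | h
      · rw [h] at hR; simp at hR
      · exact h
    have hR1' : (0 : ℝ) < (sqrtHiNat N : ℕ) := by exact_mod_cast hR1
    apply le_of_lt
    rw [Real.sqrt_lt' hR1']
    have hR' : (N : ℝ) < ((sqrtHiNat N : ℕ) : ℝ) ^ 2 := by rw [pow_two]; exact_mod_cast hR
    refine lt_of_le_of_lt ?_ hR'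
    rw [hN]; push_cast
    exact hX2

end DI

end Literature.Analysis.FluidPDE.FluidComputer
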